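import Summits.QuantumFields.YangMills.Theorems.AlphaInputsT3ACv3SymAvgCoverGeometry
import HarnessLib

/-!
# `AlphaInputsT3ACv3SymAvgReg68Reading` — R3 2′χ (O″χ) B1, the (α)-seam re-reading R-ii, analytic core (69)_sym: **THE (68) READING** — the read-local (68) bound
# `pdevOn (Δ′-box on ηℤ³) (lift U) ≤ ρ` of `reg68LocalSet` controls EVERY torus plaquette with all corners in the cover `Δ′(p′)` (`plaqsIn 0 (plaqCover p′)`): each such
# plaquette is the projection of an integer plaquette of the (68)-box — lane `pub-balaban3d` ∕ cell `ym3-torus`, seat `ym-ust-19936-w2` (g4)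

WHY (★★OWNER RULING g26-№14 (c) «the (71)_sym row per recorded plaquette from `large67RecSet ∧ reg68LocalSet` via (69)_sym»; LEAD ★w1-19936 g3 ✓`…SmallFactor71SymT3`
`h71_of_recLarge_of_eq69sym`; ★w7-19936 g3's assembly `dist1_plaqHol_iter_le_blockSum_of_cover` takes `hU : ∀ q ∈ plaqsIn 0 (plaqCover p′), ‖U(∂q) − 1‖ ≤ a`).  The class of
record `AlphaInputsT3AC.reg68LocalSet` states (68) on the LIFT `liftCfg 𝔊 U : ηℤ³ → U(N)` as `B7Prop1Local.pdevOn` over the integer box `[loK, plaqHiK]` of the recorded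
plaquette; the (69)_sym pieces (ii)–(iv) (`…SymAvgGaugeClamp`, `…SymAvgPlaqAssembly`, `…SymAvgBlockSum69`) read TORUS plaquettes with all four corners in `Carriers.plaqCover p′`.
This file is the one-directional dictionary between the two: by the sibling's coordinates (`SymAvgCover.mem_plaqCover_iff_exists_offset`: the cover is the product box of
offsets `< side_κ` above the lower corner `(p′.src)_κ·L^j`), a torus plaquette `q` with corners in the cover has integer offsets `a` with `a + e_{q.μ} + e_{q.ν}` still in
the box, so `(L^j·z(p′) + a; q.μ, q.ν)` is a plaquette of the (68)-box projecting to `q` (`LiftBridge.liftCfg` reads `U` through `TorusLift.projSite`;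
`N08AlphaRegSel.norm_hol_liftCfg_sub_one`), and `B7Prop1Local.le_pdevOn` bounds it.
WHAT IS HERE (def-free).  §1 (any `Scales`∕`GroupModel`, level `j < m + K`): `inBox_loK_plaqHiK_iff` (the (68)-box `[loK L j (zOf p′), plaqHiK L j (zOf p′) μ ν]` in offset letters),
★★ `dist1_plaqHol_le_of_pdevOn` (`pdevOn … (liftCfg 𝔊 U) ≤ ρ ⟹ ∀ q ∈ plaqsIn 0 (plaqCover p′), dist1 U(∂q) ≤ ρ`).  §2 (T³, `SU(2)`, the run's scales):
★★ `norm_plaqHol_le_of_mem_reg68LocalSet` (`U ∈ reg68LocalSet k h ⟹ ∀ j < k, ∀ p′ ∈ P_j(h), ∀ q ∈ plaqsIn 0 (plaqCover p′), ‖U(∂q) − 1‖ ≤ ½C68·g_jp(g_j)·L^{−2j}` —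
the `hU` binder of the (69)_sym assembly at `a := ½C68·eps1Of(j)·(L^j)⁻²`).
HONEST FRAMING.  Lattice bookkeeping; nothing of [Balaban1985UV3] (68)–(71) is asserted beyond these letters; count-neutral helper toward R3 2′χ (item 19936), registry untouched;
nothing about d = 4, the continuum, or a mass gap; YM₃ on T³ is rung R3 of the programme, NOT the Clay problem.

References: T. Bałaban, Commun. Math. Phys. 102 (1985) 255–275 [Balaban1985UV3] ((68)–(70) p.273); CMP 98 (1985) 17–51 [Balaban1985Averaging] ((9) p.18, p.24 and p.26).
-/

set_option autoImplicit false

noncomputable section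

namespace Summit.QuantumFields.YangMills.Theorems.SymAvgCover

open scoped Matrix Matrix.Norms.L2Operator
open Literature.MathematicalPhysics.QuantumFieldTheory.Balaban1983to89
open Literature.MathematicalPhysics.QuantumFieldTheory.Balaban1983to89.B10 (pFun)
open Literature.MathematicalPhysics.QuantumFieldTheory.Balaban1983to89.B10Eq38TorusDomains (toFine toFine_zero cornerSet plaqsIn mem_plaqsIn_iff)
open Literature.MathematicalPhysics.QuantumFieldTheory.Balaban1985CMP102.Setting
open B7Prop1Explicit (hol plaqWord e e_apply U1)
open B7Prop1Local (pdevOn loK plaqHiK InBox PlaqIn le_pdevOn)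
open B7Prop2Explicit (unitaryUnits_le_U1)
open B10Eq70Squaring (side)
open Summit.QuantumFields.Balaban3D.Carriers
open Summit.QuantumFields.Balaban3D.Proofs.Primitives (AlphaConsts)
open Summit.QuantumFields.Balaban3D.Proofs.LiftBridge (liftCfg liftCfg_mem_unitaryUnits)
open Summit.QuantumFields.Balaban3D.Proofs.TorusLift (projSite projSite_apply zOf zOf_apply)
open Summit.QuantumFields.Balaban3D.Proofs.Run3SmallFactors (codeZ)
open Summit.QuantumFields.YangMills.Theorems.BalabanUVNodesN08AlphaRegSel (plaqVar norm_hol_liftCfg_sub_one)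

/-! ## §1 The (68)-box controls every torus plaquette over the cover -/

section Generic

variable {L : ℕ} {S : Scales L} {G : Type} [GaugeGroup G] [MeasurableSpace G] (𝔊 : GroupModel G) {j : ℕ}

omit [MeasurableSpace G] in
/-- The integer box `[loK L j z(p′), plaqHiK L j z(p′) μ ν]` of (68)∕(70) in offset letters: `y` lies in it iff `0 ≤ y_κ − L^j·(p′.src)_κ ≤ side_κ − 1` with `side` taken in the
directions `μ, ν`. [cite: Balaban1985UV3, (68)–(70) p.273] -/
theorem inBox_loK_plaqHiK_iff (p : Plaq S.P j) (μ ν : Fin S.P.d) (y : B7Prop1Explicit.Site S.P.d) :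
    InBox (loK L j (zOf p)) (plaqHiK L j (zOf p) μ ν) y ↔
      ∀ κ, 0 ≤ y κ - (L : ℤ) ^ j * (((p.src κ).val : ℕ) : ℤ) ∧ y κ - (L : ℤ) ^ j * (((p.src κ).val : ℕ) : ℤ) + 1 ≤ (side (S.P.L ^ j) μ ν κ : ℤ) := by
  have hL : (S.P.L : ℤ) = L := rfl
  unfold InBox loK plaqHiK
  refine forall_congr' fun κ => ?_
  simp only [zOf_apply]
  unfold side
  split_ifs with h <;> push_cast <;> rw [hL] <;> constructor <;> rintro ⟨h1, h2⟩ <;> constructor <;> linarith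

/-- **★★ THE (68)-BOX CONTROLS THE TORUS PLAQUETTES OVER THE COVER** (`j < m + K`, any `Scales`∕`GroupModel`): if the lift `liftCfg 𝔊 U` has all plaquette variables of the
integer box of the four `j`-blocks under `p′` within `ρ` of `1` (`B7Prop1Local.pdevOn ≤ ρ`, the (68) row of `reg68LocalSet`), then every TORUS plaquette with all four corners in
`Δ′(p′)` satisfies `dist1 U(∂q) ≤ ρ` — it is the projection of the integer plaquette `(L^j·z(p′) + a; q.μ, q.ν)` of the box, `a` = the offsets of `q.src`
(`mem_plaqCover_iff_exists_offset`; room `+1` in the directions of `q` from the far corner's membership and `offset_unique`). [cite: Balaban1985UV3, (68)–(70) p.273;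
Balaban1985Averaging, (9) p.18] -/
theorem dist1_plaqHol_le_of_pdevOn (hj : j + 1 ≤ S.P.m + S.P.K) (p : Plaq S.P j) (U : GaugeField S.P 0 G) {ρ : ℝ}
    (h68 : pdevOn (loK L j (zOf p)) (plaqHiK L j (zOf p) p.μ p.ν) (liftCfg 𝔊 U) ≤ ρ) :
    ∀ q ∈ plaqsIn 0 (plaqCover p), dist1 (GaugeField.plaqHol U q) ≤ ρ := by
  intro q hq
  have hj0 : j ≤ S.P.m + S.P.K := (Nat.le_succ j).trans hj
  have hqμν : q.μ ≠ q.ν := ne_of_lt q.hμν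
  rw [mem_plaqsIn_iff] at hq
  have hsrc : q.src ∈ plaqCover p := hq (by simp [cornerSet])
  have hfar : (q.src.shift q.μ).shift q.ν ∈ plaqCover p := hq (by simp [cornerSet])
  obtain ⟨a, ha, hqa⟩ := (mem_plaqCover_iff_exists_offset hj0 p q.src).mp hsrc
  obtain ⟨a', ha', hqa'⟩ := (mem_plaqCover_iff_exists_offset hj0 p _).mp hfar
  -- the far corner's offsets are `a + e_μ + e_ν`
  have hfar_coord : ∀ κ, ((q.src.shift q.μ).shift q.ν) κ = q.src κ + ((if κ = q.μ ∨ κ = q.ν then 1 else 0 : ℕ) : ZMod (S.P.sitesPerDir 0)) := by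
    intro κ
    simp only [Site.shift_apply]
    by_cases h1 : κ = q.ν
    · subst h1; simp [hqμν.symm]
    · by_cases h2 : κ = q.μ
      · subst h2; simp [h1]
      · simp [h1, h2]
  have ha1 : ∀ κ, a κ + (if κ = q.μ ∨ κ = q.ν then 1 else 0) < side (S.P.L ^ j) p.μ p.ν κ := by
    intro κ
    have h := hqa' κ
    rw [hfar_coord κ, hqa κ, ← Nat.cast_add, add_assoc] at h
    have hle : a κ + (if κ = q.μ ∨ κ = q.ν then 1 else 0) ≤ 2 * S.P.L ^ j := by
      have := ha κ; have := side_le (S.P.L ^ j) p.μ p.ν κ; split_ifs <;> omega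
    have heq := offset_unique hj hle ((ha' κ).le.trans (side_le _ _ _ _))
      (add_left_cancel (a := ((((p.src κ).val * S.P.L ^ j : ℕ)) : ZMod (S.P.sitesPerDir 0))) (by push_cast at h ⊢; linear_combination h))
    rw [heq]; exact ha' κ
  -- the integer plaquette of the box projecting to `q`
  set y : B7Prop1Explicit.Site S.P.d := fun κ => (L : ℤ) ^ j * (((p.src κ).val : ℕ) : ℤ) + (a κ : ℤ) with hy
  have hproj : projSite y = q.src := by
    funext κ
    rw [projSite_apply, hqa κ, hy, show S.P.L = L from rfl]
    push_cast
    ring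
  have hplaq : PlaqIn (loK L j (zOf p)) (plaqHiK L j (zOf p) p.μ p.ν) (y, q.μ, q.ν) := by
    constructor
    · rw [inBox_loK_plaqHiK_iff]
      intro κ
      simp only [hy]
      have h1 := ha κ
      constructor
      · linarith [Int.natCast_nonneg (a κ)]
      · have : ((a κ : ℕ) : ℤ) + 1 ≤ side (S.P.L ^ j) p.μ p.ν κ := by exact_mod_cast h1
        linarith
    · rw [inBox_loK_plaqHiK_iff]
      intro κ
      simp only [hy, Pi.add_apply, e_apply]
      have h1 := ha1 κ
      have hcast : (((if κ = q.μ ∨ κ = q.ν then 1 else 0 : ℕ)) : ℤ) = (if κ = q.μ then 1 else 0) + (if κ = q.ν then 1 else 0) := by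
        by_cases h1 : κ = q.μ
        · subst h1; simp [hqμν]
        · by_cases h2 : κ = q.ν
          · subst h2; simp [h1]
          · simp [h1, h2]
      have : ((a κ : ℕ) : ℤ) + (((if κ = q.μ ∨ κ = q.ν then 1 else 0 : ℕ)) : ℤ) + 1 ≤ side (S.P.L ^ j) p.μ p.ν κ := by exact_mod_cast h1
      rw [hcast] at this
      constructor
      · have : (0 : ℤ) ≤ (if κ = q.μ then 1 else 0) + (if κ = q.ν then 1 else 0) := by split_ifs <;> norm_num
        linarith [Int.natCast_nonneg (a κ)]
      · linarith
  -- read the bound through the lift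
  haveI : NeZero 𝔊.N := ⟨Nat.pos_iff_ne_zero.mp 𝔊.N_pos⟩
  letI : CStarAlgebra (Matrix (Fin 𝔊.N) (Fin 𝔊.N) ℂ) := {}
  have hV : ∀ x κ, liftCfg 𝔊 U x κ ∈ U1 (Matrix (Fin 𝔊.N) (Fin 𝔊.N) ℂ) := fun x κ => unitaryUnits_le_U1 (liftCfg_mem_unitaryUnits 𝔊 U x κ)
  have hle := le_pdevOn hV hplaq
  rw [norm_hol_liftCfg_sub_one 𝔊 U y q.μ q.ν, hproj] at hle
  have hvar : plaqVar U q.src q.μ q.ν = GaugeField.plaqHol U q := rfl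
  rw [hvar] at hle
  exact hle.trans h68

end Generic

/-! ## §2 T³: the `hU` binder of the (69)_sym assembly from membership in `reg68LocalSet` -/

section T3

open Literature.MathematicalPhysics.QuantumFieldTheory.Balaban1983to89.T3ContinuumYM3Torus

variable (F : T3Family) (𝔠 : AlphaConsts F.L (suGroupModel 2).N) (γ : ℝ) (hγ : 0 < γ) (hγ1 : γ ≤ (min 𝔠.gamma0 1) ^ 2) (K : ℕ)

variable {F 𝔠 γ hγ hγ1 K} in
/-- **★★ MEMBERSHIP IN THE READ-LOCAL (68) SET BOUNDS THE FINE PLAQUETTES OVER THE COVER OF EVERY RECORDED PLAQUETTE** (`k ≤ K`): for `U ∈ reg68LocalSet k h`, every recorded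
`p′ ∈ P_j(h)`, `j < k`, and every torus plaquette `q` with all corners in `Δ′(p′)`: `‖U(∂q) − 1‖ ≤ ½C68·g_jp(g_j)·L^{−2j}` — the `hU` binder of the (69)_sym assembly
(`dist1_plaqHol_iter_le_blockSum_of_cover`) at `a := ½C68·eps1Of(j)·(L^j)⁻²`. [cite: Balaban1985UV3, (68) p.273] -/
theorem norm_plaqHol_le_of_mem_reg68LocalSet {k : ℕ} (hk : k ≤ K) {h : Hist (F.P K) k}
    {U : GaugeField (F.P K) 0 (Matrix.specialUnitaryGroup (Fin 2) ℂ)} (hU : U ∈ AlphaInputsT3AC.reg68LocalSet F 𝔠 γ hγ hγ1 K k h)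
    (j : Fin k) {p : Plaq (F.P K) j} (hp : p ∈ h j) :
    ∀ q ∈ plaqsIn 0 (plaqCover p), ‖((GaugeField.plaqHol U q : Matrix.specialUnitaryGroup (Fin 2) ℂ) : Matrix (Fin 2) (Fin 2) ℂ) - 1‖ ≤
      𝔠.C68 / 2 * ((T3Scales F γ hγ (hγ1.trans (sq_min_one_le _ 𝔠.gamma0_pos)) K).gk j *
        pFun 𝔠.lane.carrier.b₀ 𝔠.lane.carrier.p₀ ((T3Scales F γ hγ (hγ1.trans (sq_min_one_le _ 𝔠.gamma0_pos)) K).gk j)) *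
        (((F.L : ℝ) ^ (j : ℕ))⁻¹) ^ 2 := by
  intro q hq
  set S : Scales F.L := T3Scales F γ hγ (hγ1.trans (sq_min_one_le _ 𝔠.gamma0_pos)) K with hS
  have he : ((j : ℕ), plaqCode p) ∈ Hist.disc h := (Hist.mem_disc h _).mpr ⟨j, p, hp, rfl⟩
  have h68 := hU ((j : ℕ), plaqCode p) he
  have hjK : (j : ℕ) + 1 ≤ S.P.m + S.P.K := by
    have := AlphaInputsT3AC.le_standing_of_le (F := F) hk
    show (j : ℕ) + 1 ≤ F.m + K
    have := j.2; omega
  have hdist : dist1 (GaugeField.plaqHol U q) = ‖((GaugeField.plaqHol U q : Matrix.specialUnitaryGroup (Fin 2) ℂ) : Matrix (Fin 2) (Fin 2) ℂ) - 1‖ := rfl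
  rw [← hdist]
  have h68' : pdevOn (loK F.L (j : ℕ) (zOf p)) (plaqHiK F.L (j : ℕ) (zOf p) p.μ p.ν) (liftCfg (S := S) (suGroupModel 2) U) ≤
      𝔠.C68 / 2 * (S.gk j * pFun 𝔠.lane.carrier.b₀ 𝔠.lane.carrier.p₀ (S.gk j)) * (((F.L : ℝ) ^ (j : ℕ))⁻¹) ^ 2 := h68
  exact dist1_plaqHol_le_of_pdevOn (suGroupModel 2) hjK p U h68' q hq

end T3

end Summit.QuantumFields.YangMills.Theorems.SymAvgCover

end
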